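import Literature.RepresentationTheory.Paul1998.DetCoverCocycle
import HarnessLib

/-!
# The principal `det^{1/2}` section over `U(α, β)` and Paul's record (1.2.1)–(1.2.2) at every real rank, modulo
# strong continuity of the section at `1`

Topic `RepresentationTheory/Paul1998`; namespace `Literature.RepresentationTheory.Paul1998.MetaplecticSplitting`.
KERNEL (definitions with bodies + theorems; 0 named facts).  Sequel of `DetCoverCocycle` (general-rank cocycle sections,
exact commutation, topology-free det-cover lifting).

The record `DualPairCoverDatum.DetCoverLifting` asks in addition for `Continuous L`; B08-1's
`detCoverLifting_of_cocycleSections` reduces this to continuity AT `1` of the section `τ` (strong operator topology of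
`ArchMetaplecticStrongTopology`) and of the square root `σ`.  An arbitrary (choice-valued) section has no reason to be
continuous, so this file FIXES the sign coherently:

* §4 `prinSection hR1 G` — the metaplectic element over `toSp G` whose `det^{1/2}`-value `θ` (the character `detHalf` of
  `Weil1964.ArchMetaplecticUnitaryDetCharacter`) is the PRINCIPAL square root `prinRoot G = (det G)^{1/2}`;
  `prinSection_mul`: its cocycle is the coboundary of `prinRoot`; `prinRoot` is continuous at `G = 1` (`det 1 = 1` lies
  in the slit plane);
* §5 for the dual pair: `prinSectionV/W`, the square roots `prinSqrtV(g) = √det(g ⊗ 1) · det(g)^{−|S|}` (resp. `W`),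
  CONTINUOUS AT `1` (functions of `det g` alone), the cocycle data, and
  **`detCoverLifting_of_continuousAt_prinSection`**: `(Mp₂.coverDatum P Q R S h1 h2).DetCoverLifting` — the full record,
  every real rank — from the SINGLE remaining analytic input `ContinuousAt (prinSectionV h1) 1 ∧ ContinuousAt (prinSectionW h1) 1`
  (i.e. `g ↦ τ_V(g) f` continuous into `L²` at `g = 1` for every Schwartz `f`, `MpS.continuousAt_iff`).

NOT here: that analytic input (at real rank ≤ 1 it is the tree's `JunctionContinuityKAK`; in general it is the strong
continuity of the metaplectic representation along `toSp(U(α,β))` near the identity).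

## References

* [Paul1998] A. Paul, *Howe correspondence for real unitary groups*, J. Funct. Anal. 159 (1998), §1.2 (1.2.1)–(1.2.2).
* [Folland1989] G. B. Folland, *Harmonic Analysis in Phase Space*, Princeton UP 1989, §4.2 Thm. (4.37).
-/

set_option autoImplicit false

noncomputable section

open Matrix Complex
open scoped ComplexConjugate

namespace Literature.RepresentationTheory.Paul1998

namespace MetaplecticSplitting

open Literature.RepresentationTheory.KonnoKonno2007 Literature.RepresentationTheory.KonnoKonno2007.RealDualPair
open Literature.NumberTheory.Weil1964 Literature.NumberTheory.Weil1964.MpS Literature.NumberTheory.Weil1964.UnitaryBall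
open Literature.NumberTheory.Automorphic Literature.NumberTheory.Automorphic.UnitaryGroup
open Literature.Analysis.SegalBargmann

/-! ## 4. The principal-root section: `σ` continuous at `1`, so the record follows from `ContinuousAt τ 1` alone -/

section Principal

variable {α β : Type*} [Fintype α] [DecidableEq α] [Fintype β] [DecidableEq β]

/-- The principal square root `√(det G)`. [cite: Paul1998, §1.2 (1.2.2)] -/
def prinRoot (G : UForm α β) : ℂ := (mat G).det ^ ((2 : ℂ)⁻¹)

/-- `√(det G)² = det G`. [cite: Paul1998, §1.2 (1.2.2)] -/
theorem prinRoot_sq (G : UForm α β) : prinRoot G ^ 2 = (mat G).det := by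
  rw [prinRoot]
  exact_mod_cast Complex.cpow_nat_inv_pow (mat G).det two_ne_zero

/-- `√(det G) ≠ 0`. [cite: Paul1998, §1.2 (1.2.2)] -/
theorem prinRoot_ne_zero (G : UForm α β) : prinRoot G ≠ 0 := fun h => by
  have h1 := prinRoot_sq G
  rw [h, zero_pow two_ne_zero] at h1
  exact det_mat_ne_zero G h1.symm

/-- **The principal metaplectic section over `toSp(U(α,β))`**: the metaplectic element `τ(G)` over `toSp G` whose
`det^{1/2}`-value is the PRINCIPAL square root `√(det G)` (exactly one of the two elements over `toSp G` qualifies).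
[cite: Paul1998, §1.2 (1.2.1)–(1.2.2); Folland1989, §4.2 Thm. (4.37)] -/
def prinSection (hR1 : Folland1989_Thm_4_37_ab (α ⊕ β)) (G : UForm α β) : MpS (α ⊕ β) :=
  if detHalf (Classical.choose (hR1 (UForm.toSp α β G))) G = prinRoot G then
    Classical.choose (hR1 (UForm.toSp α β G))
  else negOne * Classical.choose (hR1 (UForm.toSp α β G))

/-- `τ(G)` lies over `toSp G`. [cite: Folland1989, §4.2 Thm. (4.37)] -/
theorem proj_prinSection (hR1 : Folland1989_Thm_4_37_ab (α ⊕ β)) (G : UForm α β) :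
    proj (prinSection hR1 G) = UForm.toSp α β G := by
  have h := (Classical.choose_spec (hR1 (UForm.toSp α β G))).1
  unfold prinSection
  split_ifs
  · exact h
  · rw [map_mul, proj_negOne, one_mul, h]

/-- `τ(G)` is metaplectic. [cite: Folland1989, §4.2 Thm. (4.37)] -/
theorem isMetaplectic_prinSection (hR1 : Folland1989_Thm_4_37_ab (α ⊕ β)) (G : UForm α β) :
    IsMetaplectic (prinSection hR1 G) := by
  have h := (Classical.choose_spec (hR1 (UForm.toSp α β G))).2
  unfold prinSection
  split_ifs
  · exact h
  · exact h.negOne_mul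

/-- **`θ(τ(G)) = √(det G)`** (principal root). [cite: Paul1998, §1.2 (1.2.2)] -/
theorem detHalf_prinSection (hR1 : Folland1989_Thm_4_37_ab (α ⊕ β)) (G : UForm α β) :
    detHalf (prinSection hR1 G) G = prinRoot G := by
  set x := Classical.choose (hR1 (UForm.toSp α β G)) with hx
  have hsq : detHalf x G ^ 2 = prinRoot G ^ 2 := by
    rw [prinRoot_sq]; exact detHalf_sq (Classical.choose_spec (hR1 (UForm.toSp α β G))).2
      (Classical.choose_spec (hR1 (UForm.toSp α β G))).1
  unfold prinSection
  rw [← hx]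
  split_ifs with h
  · exact h
  · rw [detHalf_negOne_mul]
    rcases sq_eq_sq_iff_eq_or_eq_neg.1 hsq with h' | h'
    · exact absurd h' h
    · rw [h', neg_neg]

/-- **The cocycle of the principal section is the coboundary of `√det`.** [cite: Paul1998, §1.2 (1.2.1)–(1.2.2)] -/
theorem prinSection_mul (hR1 : Folland1989_Thm_4_37_ab (α ⊕ β)) (hR2 : Folland1989_Thm_4_37_c (α ⊕ β)) (G₁ G₂ : UForm α β) :
    prinSection hR1 G₁ * prinSection hR1 G₂ =
      (if prinRoot G₁ * prinRoot G₂ = prinRoot (G₁ * G₂) then 1 else negOne) * prinSection hR1 (G₁ * G₂) := by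
  have hm₁ := isMetaplectic_prinSection hR1 G₁
  have hm₂ := isMetaplectic_prinSection hR1 G₂
  have hm₁₂ := isMetaplectic_prinSection hR1 (G₁ * G₂)
  have hp₁ := proj_prinSection hR1 G₁
  have hp₂ := proj_prinSection hR1 G₂
  have hmet : IsMetaplectic (prinSection hR1 G₁ * prinSection hR1 G₂) := hR2 _ _ hm₁ hm₂
  have hproj : proj (prinSection hR1 (G₁ * G₂)) = proj (prinSection hR1 G₁ * prinSection hR1 G₂) := by
    rw [map_mul, hp₁, hp₂, proj_prinSection, map_mul]
  have hmul := detHalf_mul hm₁ hm₂ hp₁ hp₂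
  rw [detHalf_prinSection, detHalf_prinSection] at hmul
  rcases hm₁₂.eq_or_eq_negOne_mul hmet hproj with h | h
  · have hθ : prinRoot G₁ * prinRoot G₂ = prinRoot (G₁ * G₂) := by rw [← hmul, h, detHalf_prinSection]
    rw [if_pos hθ, one_mul, h]
  · have hθ : prinRoot G₁ * prinRoot G₂ ≠ prinRoot (G₁ * G₂) := by
      rw [← hmul, h, detHalf_negOne_mul, detHalf_prinSection]
      intro h0
      have h2 : (2 : ℂ) * prinRoot (G₁ * G₂) = 0 := by linear_combination -h0
      exact prinRoot_ne_zero _ ((mul_eq_zero.1 h2).resolve_left two_ne_zero)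
    rw [if_neg hθ, h]

/-- `G ↦ det G` is continuous on `U(α, β)`. [folklore] -/
private theorem continuous_det_mat : Continuous fun G : UForm α β => (mat G).det :=
  (Units.continuous_val.comp continuous_subtype_val).matrix_det

/-- **`√(det G)` is continuous at `G = 1`** (`det 1 = 1` lies in the slit plane). [cite: Paul1998, §1.2 (1.2.2)] -/
theorem continuousAt_prinRoot_one : ContinuousAt (prinRoot : UForm α β → ℂ) 1 := by
  have h1 : (mat (1 : UForm α β)).det ∈ Complex.slitPlane := by
    rw [mat_one, Matrix.det_one]; exact Complex.one_mem_slitPlane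
  have h2 : ContinuousAt (fun z : ℂ => z ^ ((2 : ℂ)⁻¹)) ((mat (1 : UForm α β)).det) := continuousAt_cpow_const h1
  exact h2.comp (f := fun G : UForm α β => (mat G).det) continuous_det_mat.continuousAt

end Principal

/-! ## 5. The record at every real rank, GIVEN strong continuity of the principal sections at `1` -/

section Record

variable {P Q R S : Type*} [Fintype P] [DecidableEq P] [Fintype Q] [DecidableEq Q] [Fintype R] [DecidableEq R]
  [Fintype S] [DecidableEq S]

/-- **The principal `V`-section** `g ↦ τ(g ⊗ 1)` over `ι_V` (its `det^{1/2}`-value is `√det(g ⊗ 1)`).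
[cite: Paul1998, §1.2 (1.2.1)] -/
def prinSectionV (hR1 : Folland1989_Thm_4_37_ab (DPIdx P Q R S)) (g : UForm P Q) : MpS (DPIdx P Q R S) :=
  prinSection (α := (P × R) ⊕ (Q × S)) (β := (P × S) ⊕ (Q × R)) hR1 (toBig P Q R S (g, 1))

/-- **The principal `W`-section** `h ↦ τ(1 ⊗ h)` over `ι_W`. [cite: Paul1998, §1.2 (1.2.1)] -/
def prinSectionW (hR1 : Folland1989_Thm_4_37_ab (DPIdx P Q R S)) (h : UForm R S) : MpS (DPIdx P Q R S) :=
  prinSection (α := (P × R) ⊕ (Q × S)) (β := (P × S) ⊕ (Q × R)) hR1 (toBig P Q R S (1, h))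

/-- The `V`-side square root `σ_V(g) = √(det(g ⊗ 1)) · det(g)^{−|S|}` of `det^{|R|−|S|}`. [cite: Paul1998, §1.2 (1.2.2)] -/
def prinSqrtV (g : UForm P Q) : ℂ :=
  prinRoot (toBig P Q R S (g, 1)) * (((Matrix.GeneralLinearGroup.det (g : GL (P ⊕ Q) ℂ) : ℂˣ) : ℂ)) ^ (-(Fintype.card S : ℤ))

/-- The `W`-side square root `σ_W(h) = √(det(1 ⊗ h)) · det(h)^{−|Q|}` of `det^{|P|−|Q|}`. [cite: Paul1998, §1.2 (1.2.2)] -/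
def prinSqrtW (h : UForm R S) : ℂ :=
  prinRoot (toBig P Q R S (1, h)) * (((Matrix.GeneralLinearGroup.det (h : GL (R ⊕ S) ℂ) : ℂˣ) : ℂ)) ^ (-(Fintype.card Q : ℤ))

/-- `σ_V ≠ 0`. [cite: Paul1998, §1.2 (1.2.2)] -/
theorem prinSqrtV_ne_zero (g : UForm P Q) : prinSqrtV (R := R) (S := S) g ≠ 0 :=
  mul_ne_zero (prinRoot_ne_zero _) (zpow_ne_zero _ (Units.ne_zero _))

/-- `σ_W ≠ 0`. [cite: Paul1998, §1.2 (1.2.2)] -/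
theorem prinSqrtW_ne_zero (h : UForm R S) : prinSqrtW (P := P) (Q := Q) h ≠ 0 :=
  mul_ne_zero (prinRoot_ne_zero _) (zpow_ne_zero _ (Units.ne_zero _))

/-- `z ↦ (z^m)^{1/2} z^{−s}` is continuous at `z = 1`. [folklore] -/
private theorem continuousAt_root_aux (m : ℕ) (s : ℤ) :
    ContinuousAt (fun z : ℂ => (z ^ m) ^ ((2 : ℂ)⁻¹) * z ^ (-s)) 1 := by
  refine ContinuousAt.mul ?_ (continuousAt_zpow₀ 1 (-s) (Or.inl one_ne_zero))
  have h1 : ((1 : ℂ) ^ m) ∈ Complex.slitPlane := by rw [one_pow]; exact Complex.one_mem_slitPlane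
  have h2 : ContinuousAt (fun w : ℂ => w ^ ((2 : ℂ)⁻¹)) ((1 : ℂ) ^ m) := continuousAt_cpow_const h1
  exact h2.comp (f := fun z : ℂ => z ^ m) (continuous_pow m).continuousAt

/-- `g ↦ det g` is continuous on `U(P,Q)` and equals `1` at `1`. [folklore] -/
private theorem continuous_detU : Continuous fun g : UForm P Q =>
    (((Matrix.GeneralLinearGroup.det (g : GL (P ⊕ Q) ℂ) : ℂˣ) : ℂ)) := by
  have h : (fun g : UForm P Q => (((Matrix.GeneralLinearGroup.det (g : GL (P ⊕ Q) ℂ) : ℂˣ) : ℂ))) =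
      fun g : UForm P Q => (((g : GL (P ⊕ Q) ℂ) : Matrix (P ⊕ Q) (P ⊕ Q) ℂ)).det := by
    funext g; rw [Matrix.GeneralLinearGroup.val_det_apply]
  rw [h]
  exact (Units.continuous_val.comp continuous_subtype_val).matrix_det

/-- **`σ_V` is continuous at `1`** (a continuous function of `det g` near `det 1 = 1`). [cite: Paul1998, §1.2 (1.2.2)] -/
theorem continuousAt_prinSqrtV_one : ContinuousAt (prinSqrtV (P := P) (Q := Q) (R := R) (S := S)) 1 := by
  have h : prinSqrtV (P := P) (Q := Q) (R := R) (S := S) = fun g : UForm P Q =>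
      ((((Matrix.GeneralLinearGroup.det (g : GL (P ⊕ Q) ℂ) : ℂˣ) : ℂ)) ^ (Fintype.card R + Fintype.card S)) ^ ((2 : ℂ)⁻¹) *
        (((Matrix.GeneralLinearGroup.det (g : GL (P ⊕ Q) ℂ) : ℂˣ) : ℂ)) ^ (-(Fintype.card S : ℤ)) := by
    funext g; rw [prinSqrtV, prinRoot, det_mat_toBig_inl]
  rw [h]
  have h1 : (((Matrix.GeneralLinearGroup.det ((1 : UForm P Q) : GL (P ⊕ Q) ℂ) : ℂˣ) : ℂ)) = 1 := by
    rw [OneMemClass.coe_one, map_one, Units.val_one]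
  have hc := continuousAt_root_aux (Fintype.card R + Fintype.card S) (Fintype.card S : ℤ)
  rw [← h1] at hc
  exact hc.comp (f := fun g : UForm P Q => (((Matrix.GeneralLinearGroup.det (g : GL (P ⊕ Q) ℂ) : ℂˣ) : ℂ)))
    continuous_detU.continuousAt

/-- **`σ_W` is continuous at `1`.** [cite: Paul1998, §1.2 (1.2.2)] -/
theorem continuousAt_prinSqrtW_one : ContinuousAt (prinSqrtW (P := P) (Q := Q) (R := R) (S := S)) 1 := by
  have h : prinSqrtW (P := P) (Q := Q) (R := R) (S := S) = fun g : UForm R S =>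
      ((((Matrix.GeneralLinearGroup.det (g : GL (R ⊕ S) ℂ) : ℂˣ) : ℂ)) ^ (Fintype.card P + Fintype.card Q)) ^ ((2 : ℂ)⁻¹) *
        (((Matrix.GeneralLinearGroup.det (g : GL (R ⊕ S) ℂ) : ℂˣ) : ℂ)) ^ (-(Fintype.card Q : ℤ)) := by
    funext g; rw [prinSqrtW, prinRoot, det_mat_toBig_inr]
  rw [h]
  have h1 : (((Matrix.GeneralLinearGroup.det ((1 : UForm R S) : GL (R ⊕ S) ℂ) : ℂˣ) : ℂ)) = 1 := by
    rw [OneMemClass.coe_one, map_one, Units.val_one]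
  have hc := continuousAt_root_aux (Fintype.card P + Fintype.card Q) (Fintype.card Q : ℤ)
  rw [← h1] at hc
  exact hc.comp (f := fun g : UForm R S => (((Matrix.GeneralLinearGroup.det (g : GL (R ⊕ S) ℂ) : ℂˣ) : ℂ)))
    continuous_detU.continuousAt

/-- **Cocycle data of the principal `V`-section** (`pr`, metaplectic, `σ_V² = det^{|R|−|S|}`, `τ_mul`).
[cite: Paul1998, §1.2 (1.2.1)–(1.2.2)] -/
theorem prinSectionV_data (hR1 : Folland1989_Thm_4_37_ab (DPIdx P Q R S)) (hR2 : Folland1989_Thm_4_37_c (DPIdx P Q R S)) :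
    (∀ g, proj (prinSectionV hR1 g) = ι𝕎 P Q R S (g, 1)) ∧ (∀ g, IsMetaplectic (prinSectionV hR1 g)) ∧
      (∀ g : UForm P Q, (Units.mk0 (prinSqrtV (R := R) (S := S) g) (prinSqrtV_ne_zero g)) ^ 2 =
        Matrix.GeneralLinearGroup.det (g : GL (P ⊕ Q) ℂ) ^ ((Fintype.card R : ℤ) - Fintype.card S)) ∧
      ∀ g₁ g₂, prinSectionV hR1 g₁ * prinSectionV hR1 g₂ =
        (if Units.mk0 (prinSqrtV (R := R) (S := S) g₁) (prinSqrtV_ne_zero g₁) *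
              Units.mk0 (prinSqrtV (R := R) (S := S) g₂) (prinSqrtV_ne_zero g₂) =
            Units.mk0 (prinSqrtV (R := R) (S := S) (g₁ * g₂)) (prinSqrtV_ne_zero (g₁ * g₂)) then 1 else negOne) *
          prinSectionV hR1 (g₁ * g₂) := by
  refine ⟨fun g => proj_prinSection hR1 _, fun g => isMetaplectic_prinSection hR1 _, fun g => ?_, fun g₁ g₂ => ?_⟩
  · apply Units.ext
    rw [Units.val_pow_eq_pow_val, Units.val_mk0, prinSqrtV, mul_pow, prinRoot_sq, det_mat_toBig_inl,
      Units.val_zpow_eq_zpow_val, ← zpow_natCast, ← zpow_natCast, ← _root_.zpow_mul, ← zpow_add₀ (Units.ne_zero _)]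
    congr 1; push_cast; ring
  · have hbig : toBig P Q R S (g₁ * g₂, 1) = toBig P Q R S (g₁, 1) * toBig P Q R S (g₂, 1) := by
      rw [← map_mul, Prod.mk_mul_mk, mul_one]
    have hdet : (((Matrix.GeneralLinearGroup.det ((g₁ * g₂ : UForm P Q) : GL (P ⊕ Q) ℂ) : ℂˣ) : ℂ)) =
        (((Matrix.GeneralLinearGroup.det (g₁ : GL (P ⊕ Q) ℂ) : ℂˣ) : ℂ)) *
          (((Matrix.GeneralLinearGroup.det (g₂ : GL (P ⊕ Q) ℂ) : ℂˣ) : ℂ)) := by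
      rw [Subgroup.coe_mul, map_mul, Units.val_mul]
    unfold prinSectionV
    rw [hbig, prinSection_mul hR1 hR2]
    congr 1
    · refine if_congr ?_ rfl rfl
      rw [← Units.val_inj, Units.val_mul, Units.val_mk0, Units.val_mk0, Units.val_mk0, prinSqrtV, prinSqrtV, prinSqrtV,
        hbig, hdet, mul_zpow, mul_mul_mul_comm]
      exact (mul_left_inj' (mul_ne_zero (zpow_ne_zero _ (Units.ne_zero _)) (zpow_ne_zero _ (Units.ne_zero _)))).symm

/-- **Cocycle data of the principal `W`-section.** [cite: Paul1998, §1.2 (1.2.1)–(1.2.2)] -/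
theorem prinSectionW_data (hR1 : Folland1989_Thm_4_37_ab (DPIdx P Q R S)) (hR2 : Folland1989_Thm_4_37_c (DPIdx P Q R S)) :
    (∀ g, proj (prinSectionW hR1 g) = ι𝕎 P Q R S (1, g)) ∧ (∀ g, IsMetaplectic (prinSectionW hR1 g)) ∧
      (∀ g : UForm R S, (Units.mk0 (prinSqrtW (P := P) (Q := Q) g) (prinSqrtW_ne_zero g)) ^ 2 =
        Matrix.GeneralLinearGroup.det (g : GL (R ⊕ S) ℂ) ^ ((Fintype.card P : ℤ) - Fintype.card Q)) ∧
      ∀ g₁ g₂, prinSectionW hR1 g₁ * prinSectionW hR1 g₂ =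
        (if Units.mk0 (prinSqrtW (P := P) (Q := Q) g₁) (prinSqrtW_ne_zero g₁) *
              Units.mk0 (prinSqrtW (P := P) (Q := Q) g₂) (prinSqrtW_ne_zero g₂) =
            Units.mk0 (prinSqrtW (P := P) (Q := Q) (g₁ * g₂)) (prinSqrtW_ne_zero (g₁ * g₂)) then 1 else negOne) *
          prinSectionW hR1 (g₁ * g₂) := by
  refine ⟨fun g => proj_prinSection hR1 _, fun g => isMetaplectic_prinSection hR1 _, fun g => ?_, fun g₁ g₂ => ?_⟩
  · apply Units.ext
    rw [Units.val_pow_eq_pow_val, Units.val_mk0, prinSqrtW, mul_pow, prinRoot_sq, det_mat_toBig_inr,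
      Units.val_zpow_eq_zpow_val, ← zpow_natCast, ← zpow_natCast, ← _root_.zpow_mul, ← zpow_add₀ (Units.ne_zero _)]
    congr 1; push_cast; ring
  · have hbig : toBig P Q R S (1, g₁ * g₂) = toBig P Q R S (1, g₁) * toBig P Q R S (1, g₂) := by
      rw [← map_mul, Prod.mk_mul_mk, one_mul]
    have hdet : (((Matrix.GeneralLinearGroup.det ((g₁ * g₂ : UForm R S) : GL (R ⊕ S) ℂ) : ℂˣ) : ℂ)) =
        (((Matrix.GeneralLinearGroup.det (g₁ : GL (R ⊕ S) ℂ) : ℂˣ) : ℂ)) *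
          (((Matrix.GeneralLinearGroup.det (g₂ : GL (R ⊕ S) ℂ) : ℂˣ) : ℂ)) := by
      rw [Subgroup.coe_mul, map_mul, Units.val_mul]
    unfold prinSectionW
    rw [hbig, prinSection_mul hR1 hR2]
    congr 1
    · refine if_congr ?_ rfl rfl
      rw [← Units.val_inj, Units.val_mul, Units.val_mk0, Units.val_mk0, Units.val_mk0, prinSqrtW, prinSqrtW, prinSqrtW,
        hbig, hdet, mul_zpow, mul_mul_mul_comm]
      exact (mul_left_inj' (mul_ne_zero (zpow_ne_zero _ (Units.ne_zero _)) (zpow_ne_zero _ (Units.ne_zero _)))).symm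

/-- continuity at a point of a `Mp₂(𝕎)`-valued co-restriction from that of the `Mp^𝓢(𝕎)`-valued map. [folklore] -/
private theorem continuousAt_mk {X : Type*} [TopologicalSpace X] {F : X → MpS (DPIdx P Q R S)}
    (hF : ∀ t, F t ∈ Mp₂ (DPIdx P Q R S)) {t₀ : X} (h : ContinuousAt F t₀) :
    ContinuousAt (fun t => (⟨F t, hF t⟩ : Mp₂ (DPIdx P Q R S))) t₀ :=
  Mp₂.continuousAt_iff.2 (MpS.continuousAt_iff.1 h)

variable [Nonempty (P ⊕ Q)] [Nonempty (R ⊕ S)]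

/-- **THE RECORD `DetCoverLifting` FOR `Mp₂(𝕎)` AT EVERY REAL RANK, MODULO STRONG CONTINUITY AT `1` OF THE TWO
PRINCIPAL SECTIONS** — the only remaining input is analytic: `g ↦ τ_V(g) f` and `h ↦ τ_W(h) f` continuous into `L²` at
the identity for every Schwartz `f` (`MpS.continuousAt_iff`). [cite: Paul1998, §1.2 (1.2.1)–(1.2.2) p. 389 L11–31] -/
theorem detCoverLifting_of_continuousAt_prinSection (h1 : Folland1989_Thm_4_37_ab (DPIdx P Q R S))
    (h2 : Folland1989_Thm_4_37_c (DPIdx P Q R S)) (hV : ContinuousAt (prinSectionV (P := P) (Q := Q) (R := R) (S := S) h1) 1)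
    (hW : ContinuousAt (prinSectionW (P := P) (Q := Q) (R := R) (S := S) h1) 1) :
    (Mp₂.coverDatum P Q R S h1 h2).DetCoverLifting := by
  obtain ⟨hV1, hV2, hV3, hV4⟩ := prinSectionV_data (P := P) (Q := Q) (R := R) (S := S) h1 h2
  obtain ⟨hW1, hW2, hW3, hW4⟩ := prinSectionW_data (P := P) (Q := Q) (R := R) (S := S) h1 h2
  exact DualPairCoverDatum.detCoverLifting_of_cocycleSections (cocycleSectionV h1 h2 _ _ hV1 hV2 hV3 hV4)
    (cocycleSectionW h1 h2 _ _ hW1 hW2 hW3 hW4) (commute_coverV_coverW_general h1 h2)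
    (continuousAt_mk _ hV) continuousAt_prinSqrtV_one (continuousAt_mk _ hW) continuousAt_prinSqrtW_one

end Record

end MetaplecticSplitting

end Literature.RepresentationTheory.Paul1998
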